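import Literature.Combinatorics.SimpleGraph.HarmonicOneFormsFlowSpace
import Literature.Combinatorics.SimpleGraph.CutSpace
import Literature.Combinatorics.SimpleGraph.HarmonicMorphismsComposition
import Mathlib.LinearAlgebra.Trace
import Mathlib.Algebra.DirectSum.LinearMap
import Mathlib.Algebra.Order.Group.End
import HarnessLib

/-!
# `Aut(G)` acts faithfully on the harmonic 1-forms `𝓗¹(G)` (Baker–Norine 2009, Proposition 36)

Source (held, read at the page; statements VERBATIM). M. Baker, S. Norine, *Harmonic morphisms
and hyperelliptic graphs*, Int. Math. Res. Not. IMRN 2009, no. 15, 2914–2955 [BakerNorine2009]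
(held text `paper:arxiv-0707.1309`, chunks p0014–p0015), §4.3: «By functoriality, an
automorphism `α` of a graph `G` induces an automorphism `α^*` of the vector space `𝓗¹(G)`. For
later use, we note the following property of the corresponding map `Aut(G) → Aut(𝓗¹(G))`:
**Proposition 36.** If `G` is a 2-edge-connected graph of genus at least `2`, then the natural map
from `Aut(G)` to `Aut(𝓗¹(G))` is injective. *Proof.* Let `β, β′ ∈ Aut(G)`. By considering the
automorphism `α := β′β⁻¹`, it suffices to prove that if `α^*` is the identity map on `𝓗¹(G)`,
then `α` is the identity map on `G`. So suppose `α^* = Id`. Then every directed cycle in `G` is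
mapped onto itself. […] It follows that the restriction of `α` to every simple cycle `C` of `G`
is the identity map. Since `G` is 2-edge-connected, this implies that `α` is the identity map on
all of `G`.» «**Remark 37.** Proposition 36 is the analogue of the fact from algebraic geometry
that if `X` is a Riemann surface of genus at least `2`, then the natural map from `Aut(X)` to
`Aut(Ω¹(X))` is injective.» (Here `𝓗¹(G) = H¹(G, ℝ)` is the space of flows, §4.3; the tree's
`IsGraphFlow` / `flowSubmodule` of `HarmonicOneForms`, `HarmonicOneFormsFlowSpace`, and, read
along an orientation `σ`, the flow space `σ.flowSpace` of `FlowSpace`.)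

## What is formalised (simple graphs; automorphisms are Mathlib's `G ≃g G`; `K` any field, an
## ordered field — e.g. `ℝ` — where B–N take `ℝ`)

* §1–§2 the action: the image edge `α(e) = α.mapEdgeSet e`, the orientation sign `orientSign σ K α e`
  (`+1` if `α` carries the orientation of `e` to that of `α(e)`, else `−1`), the pull-backs
  `edgePull σ K α` on edge vectors (`(α^*x)(e) = ε_α(e) x(α e)`, i.e. B–N's `(α^*ω)(e) = ω(α(e))`
  read along `σ`: `edgeVec_cochainPullback`) and `vertexPull K α` on vertex functions; the
  incidence matrix is equivariant up to sign (`incMatrix_map_map`), so `D ∘ α^* = α^* ∘ D` and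
  `α^*(yᵀD) = (α^*y)ᵀD` (`incMatrix_mulVec_edgePull`, `edgePull_vecMul`), and `α^*` preserves the
  flow space and the cut space; the group law `(αβ)^* = β^*α^*`, `1^* = id` (§5).
* §3–§4 the traces: `tr(α^*|C⁰) = #Fix(α)` (`trace_vertexPull`), `tr(α^*|C¹) = Σ_{α e = e} ε_α(e)
  = e₊ − e₋` (`trace_edgePull`, `sum_orientSign_eq`: `e₊` = edges with both ends fixed, `e₋` =
  edges fixed with their ends exchanged), and **the Hopf trace formula**
  `#Fix(α) − (e₊ − e₋) = 1 − tr(α^*|𝓗¹(G))` for a connected graph over an ordered field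
  (`card_fixed_sub_sum_orientSign`; from `C¹ = cut space ⊕ flow space`, the tree's
  `isCompl_cutSpace_flowSpace`, and `cut space ≅ C⁰/constants` equivariantly).
* §6–§7 **Proposition 36** in four forms: `eq_one_of_edgePull_eq_self` (`α^* = id` on the flow
  space ⇒ `α = 1`), `eq_of_edgePull_eq` (`α^* = β^*` ⇒ `α = β`), and in B–N's 1-cochain vocabulary
  `eq_one_of_cochainPullback_eq_self`, `eq_of_cochainPullback_eq`, together with the natural map
  `oneFormPullback K : (G ≃g G) → End(H¹(G, K))` and **`oneFormPullback_injective`**.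

## Proof route (disclosed deviation from the printed proof)

B–N argue by a Case I / Case II surgery on simple cycles through a vertex of degree `≥ 3`. The
proof typed here replaces this by linear algebra on the cellular cochain complex `C⁰ → C¹` of `G`
and keeps the printed statement: (i) the Hopf trace formula above (the traces of the signed
permutation matrices of `α` on `C⁰`, `C¹` against the traces on `constants ⊕ (cut space) ⊕
(flow space)`), which under `α^*|𝓗¹ = id` reads `e₊ − e₋ = #Fix(α) − 1 + g`; (ii) rank–nullity for
the incidence mapping restricted to the edge vectors supported on the `e₊` fixed edges, whose
image lies in the functions supported on `Fix(α)` with zero sum (dimension `≤ #Fix(α) − 1`) and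
whose kernel lies in the flow space (dimension `≤ g`): this forces `e₋ = 0` and *every flow to be
supported on the fixed edges*; (iii) in a 2-edge-connected graph every edge lies on a cycle and so
carries a non-zero flow (the step «letting `ω` be the characteristic function of any simple
cycle» of B–N's proof of Theorem 58), hence every edge, and then every vertex, is fixed.

Definitions with bodies and theorems; no `sorry`; no named facts; no instances.
-/

open Finset SimpleGraph Matrix
open Literature.Combinatorics.SimpleGraph.ChipFiring
open Literature.Combinatorics.SimpleGraph.OrientedIncidence
open Literature.Combinatorics.SimpleGraph.ElementaryGraphSachs

namespace Literature.Combinatorics.SimpleGraph.BakerNorine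

/-! ### §0 Two facts of linear algebra -/

section LinearAlgebra

variable {K : Type*} [Field K]

/-- The trace is additive over an invariant complementary pair of subspaces. [folklore] -/
private theorem trace_eq_add_of_isCompl {M : Type*} [AddCommGroup M] [Module K M]
    [FiniteDimensional K M] {p q : Submodule K M} (h : IsCompl p q) {f : M →ₗ[K] M}
    (hp : Set.MapsTo f p p) (hq : Set.MapsTo f q q) :
    LinearMap.trace K M f =
      LinearMap.trace K p (f.restrict hp) + LinearMap.trace K q (f.restrict hq) := by
  let N : Bool → Submodule K M := fun b => cond b p q
  have hN : DirectSum.IsInternal N :=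
    (DirectSum.isInternal_submodule_iff_isCompl N (i := true) (j := false) (by decide)
      (Set.ext fun b => by cases b <;> simp)).2 h
  have hmaps : ∀ b, Set.MapsTo f (N b) (N b) := fun b => by
    cases b
    · exact hq
    · exact hp
  rw [LinearMap.trace_eq_sum_trace_restrict hN hmaps, Fintype.sum_bool]
  rfl

/-- Intertwined endomorphisms have the same trace. [folklore] -/
private theorem trace_eq_of_semiconj {M N : Type*} [AddCommGroup M] [Module K M] [AddCommGroup N]
    [Module K N] (e : M ≃ₗ[K] N) (f : M →ₗ[K] M) (g : N →ₗ[K] N)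
    (h : ∀ x, e (f x) = g (e x)) : LinearMap.trace K N g = LinearMap.trace K M f := by
  have hg : g = e.conj f := by
    refine LinearMap.ext fun y => ?_
    rw [LinearEquiv.conj_apply, LinearMap.comp_apply, LinearMap.comp_apply, LinearEquiv.coe_coe,
      LinearEquiv.coe_coe, h, LinearEquiv.apply_symm_apply]
  rw [hg, LinearMap.trace_conj']

/-- The linear map `x ↦ (i ↦ c i · x (π i))` on `ι → K` (a weighted pull-back along a self-map of
the index type; for a permutation `π` and signs `c` a signed permutation matrix). [folklore] -/
def weightedPull {ι : Type*} (π : ι → ι) (c : ι → K) : (ι → K) →ₗ[K] (ι → K) where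
  toFun x := fun i => c i * x (π i)
  map_add' x y := by
    funext i
    simp only [Pi.add_apply, mul_add]
  map_smul' a x := by
    funext i
    simp only [Pi.smul_apply, smul_eq_mul, RingHom.id_apply]
    ring

/-- Unfolding `weightedPull`. [folklore] -/
@[simp] private theorem weightedPull_apply {ι : Type*} (π : ι → ι) (c : ι → K) (x : ι → K) (i : ι) :
    weightedPull π c x i = c i * x (π i) := rfl

/-- **Trace of a weighted pull-back = the total weight of the fixed points** (the diagonal of a
signed permutation matrix). [folklore] -/
private theorem trace_weightedPull {ι : Type*} [Fintype ι] [DecidableEq ι] (π : ι → ι) (c : ι → K) :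
    LinearMap.trace K (ι → K) (weightedPull π c) = ∑ i, if π i = i then c i else 0 := by
  rw [LinearMap.trace_eq_matrix_trace K (Pi.basisFun K ι), Matrix.trace]
  refine sum_congr rfl fun i _ => ?_
  rw [Matrix.diag_apply, LinearMap.toMatrix_apply, Pi.basisFun_repr, Pi.basisFun_apply,
    weightedPull_apply, Pi.single_apply]
  split_ifs <;> simp

end LinearAlgebra

/-! ### §1 The action of an automorphism on the edges of an oriented graph -/

variable {V : Type*} [Fintype V] [DecidableEq V] {G : SimpleGraph V} [DecidableRel G.Adj]
variable (σ : Orientation G) (K : Type*) [Field K]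

omit [Fintype V] [DecidableEq V] [DecidableRel G.Adj] in
/-- The image edge `α(e)` has ends `α(head e)`, `α(tail e)`. [cite: BakerNorine2009, §4.3 («an
automorphism `α` of a graph `G` induces an automorphism `α^*` of […] `𝓗¹(G)`»)] -/
theorem coe_mapEdgeSet (α : G ≃g G) (e : G.edgeSet) :
    ((α.mapEdgeSet e : G.edgeSet) : Sym2 V) = s(α (σ.head e), α (σ.tail e)) := by
  rw [Iso.mapEdgeSet_apply, Hom.mapEdgeSet_coe, ← σ.mk_head_tail e, Sym2.map_mk]
  rfl

omit [Fintype V] [DecidableEq V] [DecidableRel G.Adj] in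
/-- The ends of `α(e)` are the images of the ends of `e`, in one of the two orders. [cite:
BakerNorine2009, §4.3 («an automorphism `α` of a graph `G` induces an automorphism `α^*` of […]
`𝓗¹(G)`»)] -/
theorem head_tail_mapEdgeSet (α : G ≃g G) (e : G.edgeSet) :
    (σ.head (α.mapEdgeSet e) = α (σ.head e) ∧ σ.tail (α.mapEdgeSet e) = α (σ.tail e)) ∨
      (σ.head (α.mapEdgeSet e) = α (σ.tail e) ∧ σ.tail (α.mapEdgeSet e) = α (σ.head e)) := by
  have h := σ.mk_head_tail (α.mapEdgeSet e)
  rw [coe_mapEdgeSet σ α e, Sym2.eq_iff] at h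
  rcases h with ⟨h1, h2⟩ | ⟨h1, h2⟩
  · exact Or.inl ⟨h1, h2⟩
  · exact Or.inr ⟨h1, h2⟩

/-- The **orientation sign** `ε_α(e) = +1` if `α` carries the orientation of `e` to the orientation
of `α(e)`, `−1` if it reverses it (so that the directed edge `e⃗` read along `σ` is sent to `ε_α(e)
· α(e)⃗`). [cite: BakerNorine2009, §4.3 («an automorphism `α` of a graph `G` induces an automorphism
`α^*` of […] `𝓗¹(G)`»)] -/
noncomputable def orientSign (α : G ≃g G) (e : G.edgeSet) : K :=
  if σ.head (α.mapEdgeSet e) = α (σ.head e) then 1 else -1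

omit [Fintype V] [DecidableRel G.Adj] in
/-- `ε_α(e) = 1` when the orientation is carried over. [cite: BakerNorine2009, §4.3 («an
automorphism `α` of a graph `G` induces an automorphism `α^*` of […] `𝓗¹(G)`»)] -/
theorem orientSign_of_head_eq {α : G ≃g G} {e : G.edgeSet}
    (h : σ.head (α.mapEdgeSet e) = α (σ.head e)) : orientSign σ K α e = 1 := if_pos h

omit [Fintype V] [DecidableRel G.Adj] in
/-- `ε_α(e) = −1` when the orientation is reversed. [cite: BakerNorine2009, §4.3 («an automorphism
`α` of a graph `G` induces an automorphism `α^*` of […] `𝓗¹(G)`»)] -/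
theorem orientSign_of_head_ne {α : G ≃g G} {e : G.edgeSet}
    (h : σ.head (α.mapEdgeSet e) ≠ α (σ.head e)) : orientSign σ K α e = -1 := if_neg h

omit [Fintype V] [DecidableRel G.Adj] in
/-- `ε_α(e)² = 1`. [cite: BakerNorine2009, §4.3 («an automorphism `α` of a graph `G` induces an
automorphism `α^*` of […] `𝓗¹(G)`»)] -/
theorem orientSign_mul_self (α : G ≃g G) (e : G.edgeSet) :
    orientSign σ K α e * orientSign σ K α e = 1 := by
  unfold orientSign
  split_ifs <;> norm_num

omit [Fintype V] [DecidableRel G.Adj] in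
/-- **Equivariance of the incidence matrix up to sign**: `D_{α u, α e} = ε_α(e) D_{u e}`. [cite:
BakerNorine2009, §4.3 («an automorphism `α` of a graph `G` induces an automorphism `α^*` of […]
`𝓗¹(G)`»)] -/
theorem incMatrix_map_map (α : G ≃g G) (u : V) (e : G.edgeSet) :
    σ.incMatrix K (α u) (α.mapEdgeSet e) = orientSign σ K α e * σ.incMatrix K u e := by
  rcases head_tail_mapEdgeSet σ α e with ⟨h1, h2⟩ | ⟨h1, h2⟩
  · rw [orientSign_of_head_eq σ K h1, one_mul]
    simp only [σ.incMatrix_apply K, h1, h2, α.injective.eq_iff]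
  · have hne : σ.head (α.mapEdgeSet e) ≠ α (σ.head e) := by
      rw [h1]
      exact fun h => (σ.head_ne_tail e).symm (α.injective h)
    rw [orientSign_of_head_ne σ K hne]
    simp only [σ.incMatrix_apply K, h1, h2, α.injective.eq_iff]
    by_cases hu : u = σ.head e
    · have hu' : u ≠ σ.tail e := hu ▸ σ.head_ne_tail e
      rw [if_pos hu, if_neg hu']
      ring
    · by_cases hu' : u = σ.tail e
      · rw [if_pos hu', if_neg hu]
        ring
      · rw [if_neg hu, if_neg hu']
        ring

/-! ### §2 `α^*` on edge vectors and on vertex functions -/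

/-- **`α^*` on edge vectors** (1-cochains read along `σ`): `(α^*x)(e) = ε_α(e) x(α e)` — B–N's
`(α^*ω)(e) := ω(α(e))` on directed edges (`edgeVec_cochainPullback`). [cite: BakerNorine2009, §4.3
(«an automorphism `α` of a graph `G` induces an automorphism `α^*` of […] `𝓗¹(G)`»)] -/
noncomputable def edgePull (α : G ≃g G) : (G.edgeSet → K) →ₗ[K] (G.edgeSet → K) :=
  weightedPull (fun e => α.mapEdgeSet e) (orientSign σ K α)

/-- **`α^*` on vertex functions** (0-cochains): `(α^*f)(v) = f(α v)`. [cite: BakerNorine2009, §4.3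
(«an automorphism `α` of a graph `G` induces an automorphism `α^*` of […] `𝓗¹(G)`»)] -/
def vertexPull (α : G ≃g G) : (V → K) →ₗ[K] (V → K) :=
  weightedPull (fun v => α v) (fun _ => 1)

omit [Fintype V] [DecidableRel G.Adj] in
/-- Unfolding `α^*` on edge vectors. [cite: BakerNorine2009, §4.3 («an automorphism `α` of a graph
`G` induces an automorphism `α^*` of […] `𝓗¹(G)`»)] -/
@[simp] theorem edgePull_apply (α : G ≃g G) (x : G.edgeSet → K) (e : G.edgeSet) :
    edgePull σ K α x e = orientSign σ K α e * x (α.mapEdgeSet e) := rfl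

omit [Fintype V] [DecidableEq V] [DecidableRel G.Adj] in
/-- Unfolding `α^*` on vertex functions. [cite: BakerNorine2009, §4.3 («an automorphism `α` of a
graph `G` induces an automorphism `α^*` of […] `𝓗¹(G)`»)] -/
@[simp] theorem vertexPull_apply (α : G ≃g G) (f : V → K) (v : V) :
    vertexPull K α f v = f (α v) := one_mul _

/-- The vertices fixed by `α`. [cite: BakerNorine2009, Proposition 36] -/
def fixedVertices (α : G ≃g G) : Finset V := univ.filter fun v => α v = v

/-- The edges both of whose ends are fixed by `α` (`e₊` of the Hopf trace formula). [cite: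
BakerNorine2009, Proposition 36] -/
def fixedEdges (α : G ≃g G) : Finset G.edgeSet :=
  univ.filter fun e => ∀ v, v ∈ (e : Sym2 V) → α v = v

omit [DecidableRel G.Adj] in
/-- Membership in `Fix(α)`. [cite: BakerNorine2009, Proposition 36] -/
@[simp] theorem mem_fixedVertices_iff {α : G ≃g G} {v : V} : v ∈ fixedVertices α ↔ α v = v := by
  rw [fixedVertices, mem_filter, and_iff_right (mem_univ _)]

/-- An edge is fixed at both ends iff its head and its tail are fixed. [cite: BakerNorine2009,
Proposition 36] -/
theorem mem_fixedEdges_iff {α : G ≃g G} {e : G.edgeSet} :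
    e ∈ fixedEdges α ↔ α (σ.head e) = σ.head e ∧ α (σ.tail e) = σ.tail e := by
  rw [fixedEdges, mem_filter, and_iff_right (mem_univ _)]
  constructor
  · exact fun h => ⟨h _ (σ.head_mem e), h _ (σ.tail_mem e)⟩
  · rintro ⟨h1, h2⟩ v hv
    rcases σ.mem_iff.1 hv with rfl | rfl
    exacts [h1, h2]

/-- **`D ∘ α^* = α^* ∘ D`** (the incidence mapping commutes with the two pull-backs). [cite:
BakerNorine2009, §4.3 («an automorphism `α` of a graph `G` induces an automorphism `α^*` of […]
`𝓗¹(G)`»)] -/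
theorem incMatrix_mulVec_edgePull (α : G ≃g G) (x : G.edgeSet → K) :
    σ.incMatrix K *ᵥ edgePull σ K α x = vertexPull K α (σ.incMatrix K *ᵥ x) := by
  funext u
  rw [vertexPull_apply, Matrix.mulVec, Matrix.mulVec, dotProduct, dotProduct,
    ← Equiv.sum_comp α.mapEdgeSet (fun e' => σ.incMatrix K (α u) e' * x e')]
  refine sum_congr rfl fun e _ => ?_
  rw [edgePull_apply, incMatrix_map_map, ← mul_assoc, mul_comm (σ.incMatrix K u e)]

omit [DecidableRel G.Adj] in
/-- **`α^*(yᵀD) = (α^*y)ᵀ D`** (the coboundary mapping commutes with the two pull-backs). [cite: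
BakerNorine2009, §4.3 («an automorphism `α` of a graph `G` induces an automorphism `α^*` of […]
`𝓗¹(G)`»)] -/
theorem edgePull_vecMul (α : G ≃g G) (y : V → K) :
    edgePull σ K α (y ᵥ* σ.incMatrix K) = vertexPull K α y ᵥ* σ.incMatrix K := by
  funext e
  rw [edgePull_apply, Matrix.vecMul, Matrix.vecMul, dotProduct, dotProduct,
    ← α.bijective.sum_comp (fun u' => y u' * σ.incMatrix K u' (α.mapEdgeSet e)), mul_sum]
  refine sum_congr rfl fun u _ => ?_
  rw [vertexPull_apply, incMatrix_map_map]
  have h := orientSign_mul_self σ K α e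
  linear_combination (y (α u) * σ.incMatrix K u e) * h


/-! ### §3 `α^*` preserves the flow space and the cut space; traces on `C⁰` and `C¹` -/

/-- `α^*` preserves the flow space `ker D` (Proposition 34 (1) for an automorphism, read along `σ`).
[cite: BakerNorine2009, Proposition 34 (1), Example 20] -/
theorem edgePull_mem_flowSpace (α : G ≃g G) {x : G.edgeSet → K} (hx : x ∈ σ.flowSpace K) :
    edgePull σ K α x ∈ σ.flowSpace K := by
  rw [σ.mem_flowSpace_iff K] at hx ⊢
  rw [incMatrix_mulVec_edgePull, hx, map_zero]

omit [DecidableRel G.Adj] in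
/-- `α^*` preserves the cut space `im(y ↦ yᵀD)`. [cite: BakerNorine2009, §4.3 («an automorphism `α`
of a graph `G` induces an automorphism `α^*` of […] `𝓗¹(G)`»)] -/
theorem edgePull_mem_cutSpace (α : G ≃g G) {x : G.edgeSet → K} (hx : x ∈ σ.cutSpace K) :
    edgePull σ K α x ∈ σ.cutSpace K := by
  rw [σ.mem_cutSpace_iff K] at hx ⊢
  obtain ⟨y, rfl⟩ := hx
  exact ⟨vertexPull K α y, (edgePull_vecMul σ K α y).symm⟩

/-- `α^*` maps the flow space to itself (as a `Set.MapsTo` datum for `LinearMap.restrict`). [cite: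
BakerNorine2009, Proposition 34 (1), Example 20] -/
theorem mapsTo_edgePull_flowSpace (α : G ≃g G) :
    Set.MapsTo (edgePull σ K α) (σ.flowSpace K) (σ.flowSpace K) :=
  fun _ hx => edgePull_mem_flowSpace σ K α hx

omit [DecidableRel G.Adj] in
/-- `α^*` maps the cut space to itself. [cite: BakerNorine2009, §4.3 («an automorphism `α` of a
graph `G` induces an automorphism `α^*` of […] `𝓗¹(G)`»)] -/
theorem mapsTo_edgePull_cutSpace (α : G ≃g G) :
    Set.MapsTo (edgePull σ K α) (σ.cutSpace K) (σ.cutSpace K) :=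
  fun _ hx => edgePull_mem_cutSpace σ K α hx

omit [DecidableRel G.Adj] in
/-- **`tr(α^* | C⁰) =` the number of vertices fixed by `α`.** [cite: Deo2003, Proposition 4.9.9
(Hopf's Trace Formula), for the cochain complex `C⁰(G) → C¹(G)`; BakerNorine2009, Proposition 36
(proof)] -/
theorem trace_vertexPull (α : G ≃g G) :
    LinearMap.trace K (V → K) (vertexPull K α) = ((fixedVertices α).card : K) := by
  rw [vertexPull, trace_weightedPull, sum_boole]
  rfl

/-- **`tr(α^* | C¹) = Σ_{α e = e} ε_α(e)`** (edges fixed with their orientation count `+1`, edges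
fixed with their orientation reversed count `−1`). [cite: Deo2003, Proposition 4.9.9 (Hopf's Trace
Formula), for the cochain complex `C⁰(G) → C¹(G)`; BakerNorine2009, Proposition 36 (proof)] -/
theorem trace_edgePull (α : G ≃g G) :
    LinearMap.trace K (G.edgeSet → K) (edgePull σ K α) =
      ∑ e, if α.mapEdgeSet e = e then orientSign σ K α e else 0 :=
  trace_weightedPull _ _

/-! ### §4 The Hopf trace formula `v₀ − Σ_{α e = e} ε_α(e) = 1 − tr(α^* | 𝓗¹(G))` -/

/-- The functional `f ↦ Σ_v f(v)` on `C⁰` (the augmentation). [folklore] -/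
def vertexSum : (V → K) →ₗ[K] K where
  toFun f := ∑ v, f v
  map_add' f g := by simp only [Pi.add_apply, sum_add_distrib]
  map_smul' c f := by simp only [Pi.smul_apply, smul_eq_mul, RingHom.id_apply, mul_sum]

omit [DecidableEq V] [DecidableRel G.Adj] in
/-- Unfolding the augmentation. [folklore] -/
@[simp] private theorem vertexSum_apply (f : V → K) : vertexSum K f = ∑ v, f v := rfl

variable (V) in
/-- The constant functions (`= ker(y ↦ yᵀD)` for a connected graph, GR Thm 8.3.1). [folklore] -/
def constFunctions : Submodule K (V → K) := K ∙ (fun _ => (1 : K))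

variable (V) in
/-- The functions with zero sum (the kernel of the augmentation). [folklore] -/
def sumZeroFunctions : Submodule K (V → K) := LinearMap.ker (vertexSum (V := V) K)

omit [Fintype V] [DecidableEq V] [DecidableRel G.Adj] in
/-- Membership in the constants. [folklore] -/
private theorem mem_constFunctions_iff {f : V → K} :
    f ∈ constFunctions V K ↔ ∃ c : K, f = fun _ => c := by
  rw [constFunctions, Submodule.mem_span_singleton]
  constructor
  · rintro ⟨c, rfl⟩
    exact ⟨c, funext fun v => by simp⟩
  · rintro ⟨c, rfl⟩
    exact ⟨c, funext fun v => by simp⟩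

omit [DecidableEq V] [DecidableRel G.Adj] in
/-- Membership in `{Σ = 0}`. [folklore] -/
private theorem mem_sumZeroFunctions_iff {f : V → K} : f ∈ sumZeroFunctions V K ↔ ∑ v, f v = 0 := by
  rw [sumZeroFunctions, LinearMap.mem_ker, vertexSum_apply]

omit [DecidableEq V] [DecidableRel G.Adj] in
/-- Over a field of characteristic `0` (and a non-empty vertex set) `C⁰ = constants ⊕ {Σ = 0}`.
[folklore] -/
private theorem isCompl_constFunctions_sumZeroFunctions [CharZero K] [Nonempty V] :
    IsCompl (constFunctions V K) (sumZeroFunctions V K) := by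
  have hn : (Fintype.card V : K) ≠ 0 := Nat.cast_ne_zero.2 Fintype.card_ne_zero
  refine ⟨Submodule.disjoint_def.2 fun f hf hf' => ?_, codisjoint_iff.2 (Submodule.eq_top_iff'.2 fun f => ?_)⟩
  · obtain ⟨c, rfl⟩ := (mem_constFunctions_iff K).1 hf
    rw [mem_sumZeroFunctions_iff, sum_const, card_univ, nsmul_eq_mul, mul_eq_zero] at hf'
    rw [hf'.resolve_left hn]
    rfl
  · set c : K := (∑ v, f v) / Fintype.card V
    refine Submodule.mem_sup.2 ⟨fun _ => c, (mem_constFunctions_iff K).2 ⟨c, rfl⟩, f - fun _ => c,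
      (mem_sumZeroFunctions_iff K).2 ?_, add_sub_cancel _ _⟩
    simp only [Pi.sub_apply, sum_sub_distrib, sum_const, card_univ, nsmul_eq_mul, c]
    rw [mul_div_cancel₀ _ hn, sub_self]

omit [Fintype V] [DecidableEq V] [DecidableRel G.Adj] in
/-- `α^*` fixes the constants. [cite: Deo2003, Proposition 4.9.9 (Hopf's Trace Formula), for the
cochain complex `C⁰(G) → C¹(G)`; BakerNorine2009, Proposition 36 (proof)] -/
theorem vertexPull_apply_of_mem_constFunctions (α : G ≃g G) {f : V → K}
    (hf : f ∈ constFunctions V K) : vertexPull K α f = f := by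
  obtain ⟨c, rfl⟩ := (mem_constFunctions_iff K).1 hf
  funext v
  rw [vertexPull_apply]

omit [Fintype V] [DecidableEq V] [DecidableRel G.Adj] in
/-- `α^*` maps the constants to themselves. [cite: Deo2003, Proposition 4.9.9 (Hopf's Trace
Formula), for the cochain complex `C⁰(G) → C¹(G)`; BakerNorine2009, Proposition 36 (proof)] -/
theorem mapsTo_vertexPull_constFunctions (α : G ≃g G) :
    Set.MapsTo (vertexPull K α) (constFunctions V K) (constFunctions V K) := fun f hf => by
  rw [SetLike.mem_coe, vertexPull_apply_of_mem_constFunctions K α hf]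
  exact hf

omit [DecidableEq V] [DecidableRel G.Adj] in
/-- `α^*` preserves `{Σ = 0}` (`α` permutes the vertices). [cite: Deo2003, Proposition 4.9.9 (Hopf's
Trace Formula), for the cochain complex `C⁰(G) → C¹(G)`; BakerNorine2009, Proposition 36 (proof)] -/
theorem mapsTo_vertexPull_sumZeroFunctions (α : G ≃g G) :
    Set.MapsTo (vertexPull K α) (sumZeroFunctions V K) (sumZeroFunctions V K) := fun f hf => by
  rw [SetLike.mem_coe, mem_sumZeroFunctions_iff] at hf ⊢
  simp_rw [vertexPull_apply]
  rw [α.bijective.sum_comp (fun v => f v), hf]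

omit [DecidableEq V] [DecidableRel G.Adj] in
/-- `tr(α^* | constants) = 1`. [cite: Deo2003, Proposition 4.9.9 (Hopf's Trace Formula), for the
cochain complex `C⁰(G) → C¹(G)`; BakerNorine2009, Proposition 36 (proof)] -/
theorem trace_vertexPull_constFunctions [Nonempty V] (α : G ≃g G) :
    LinearMap.trace K (constFunctions V K)
        ((vertexPull K α).restrict (mapsTo_vertexPull_constFunctions K α)) = 1 := by
  have hid : (vertexPull K α).restrict (mapsTo_vertexPull_constFunctions K α) = LinearMap.id :=
    LinearMap.ext fun f => Subtype.ext (vertexPull_apply_of_mem_constFunctions K α f.2)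
  have h1 : (fun _ : V => (1 : K)) ≠ 0 := fun h => one_ne_zero (congr_fun h (Classical.arbitrary V))
  rw [hid, LinearMap.trace_id, constFunctions, finrank_span_singleton h1, Nat.cast_one]

/-- The coboundary `f ↦ fᵀD` restricted to `{Σ = 0}`, with values in the cut space. [folklore] -/
noncomputable def coboundaryOnSumZero : sumZeroFunctions V K →ₗ[K] σ.cutSpace K :=
  LinearMap.codRestrict (σ.cutSpace K) ((σ.incMatrix K).vecMulLinear.domRestrict _)
    fun f => σ.vecMul_mem_cutSpace K f.1

omit [DecidableRel G.Adj] in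
/-- Unfolding the restricted coboundary. [folklore] -/
@[simp] private theorem coboundaryOnSumZero_apply (f : sumZeroFunctions V K) :
    (coboundaryOnSumZero σ K f : G.edgeSet → K) = (f : V → K) ᵥ* σ.incMatrix K := rfl

omit [DecidableRel G.Adj] in
/-- `cᵀ D = 0` for a constant `c`. [folklore] -/
private theorem const_vecMul_incMatrix (c : K) : (fun _ : V => c) ᵥ* σ.incMatrix K = 0 := by
  funext e
  rw [σ.vecMul_incMatrix K, sub_self, Pi.zero_apply]

omit [DecidableRel G.Adj] in
/-- For a connected graph the coboundary is a bijection `{Σ = 0} → cut space` (char. `0`): its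
kernel on `C⁰` is the constants (GR Thm 8.3.1, the tree's `vecMul_incMatrix_eq_zero_iff_reachable`).
[folklore] -/
private theorem coboundaryOnSumZero_bijective [CharZero K] (hG : G.Connected) :
    Function.Bijective (coboundaryOnSumZero σ K) := by
  haveI : Nonempty V := hG.nonempty
  have hn : (Fintype.card V : K) ≠ 0 := Nat.cast_ne_zero.2 Fintype.card_ne_zero
  constructor
  · rw [← LinearMap.ker_eq_bot, Submodule.eq_bot_iff]
    intro f hf
    rw [LinearMap.mem_ker] at hf
    have h0 : ((f : V → K) ᵥ* σ.incMatrix K) = 0 := by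
      rw [← coboundaryOnSumZero_apply, hf, Submodule.coe_zero]
    rw [σ.vecMul_incMatrix_eq_zero_iff_reachable K] at h0
    obtain ⟨v₀⟩ := ‹Nonempty V›
    have hc : (f : V → K) = fun _ => (f : V → K) v₀ := funext fun v => h0 (hG.preconnected v v₀)
    have hs := (mem_sumZeroFunctions_iff K).1 f.2
    rw [hc, sum_const, card_univ, nsmul_eq_mul, mul_eq_zero] at hs
    refine Subtype.ext ?_
    rw [hc, hs.resolve_left hn]
    rfl
  · intro x
    obtain ⟨y, hy⟩ := (σ.mem_cutSpace_iff K).1 x.2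
    set c : K := (∑ v, y v) / Fintype.card V
    have hf : (y - fun _ => c) ∈ sumZeroFunctions V K := by
      rw [mem_sumZeroFunctions_iff]
      simp only [Pi.sub_apply, sum_sub_distrib, sum_const, card_univ, nsmul_eq_mul, c]
      rw [mul_div_cancel₀ _ hn, sub_self]
    refine ⟨⟨_, hf⟩, Subtype.ext ?_⟩
    rw [coboundaryOnSumZero_apply, Submodule.coe_mk, Matrix.sub_vecMul, const_vecMul_incMatrix,
      sub_zero, hy]

/-- The coboundary as a linear equivalence `{Σ = 0} ≃ cut space` (connected graph, char. `0`).
[folklore] -/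
noncomputable def sumZeroEquivCutSpace [CharZero K] (hG : G.Connected) :
    sumZeroFunctions V K ≃ₗ[K] σ.cutSpace K :=
  LinearEquiv.ofBijective (coboundaryOnSumZero σ K) (coboundaryOnSumZero_bijective σ K hG)

omit [DecidableRel G.Adj] in
/-- `tr(α^* | cut space) = tr(α^* | {Σ = 0})`: the coboundary intertwines the two actions. [cite:
Deo2003, Proposition 4.9.9 (Hopf's Trace Formula), for the cochain complex `C⁰(G) → C¹(G)`;
BakerNorine2009, Proposition 36 (proof)] -/
theorem trace_edgePull_cutSpace [CharZero K] (hG : G.Connected) (α : G ≃g G) :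
    LinearMap.trace K (σ.cutSpace K) ((edgePull σ K α).restrict (mapsTo_edgePull_cutSpace σ K α)) =
      LinearMap.trace K (sumZeroFunctions V K)
        ((vertexPull K α).restrict (mapsTo_vertexPull_sumZeroFunctions K α)) := by
  refine trace_eq_of_semiconj (sumZeroEquivCutSpace σ K hG) _ _ fun f => Subtype.ext ?_
  change ((vertexPull K α f : V → K) ᵥ* σ.incMatrix K) = edgePull σ K α ((f : V → K) ᵥ* σ.incMatrix K)
  rw [edgePull_vecMul]

omit [DecidableRel G.Adj] in
/-- `tr(α^* | C⁰) = 1 + tr(α^* | cut space)` for a connected graph. [cite: Deo2003, Proposition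
4.9.9 (Hopf's Trace Formula), for the cochain complex `C⁰(G) → C¹(G)`; BakerNorine2009, Proposition
36 (proof)] -/
theorem trace_vertexPull_eq [CharZero K] (hG : G.Connected) (α : G ≃g G) :
    LinearMap.trace K (V → K) (vertexPull K α) =
      1 + LinearMap.trace K (σ.cutSpace K)
        ((edgePull σ K α).restrict (mapsTo_edgePull_cutSpace σ K α)) := by
  haveI : Nonempty V := hG.nonempty
  rw [trace_eq_add_of_isCompl (isCompl_constFunctions_sumZeroFunctions K)
    (mapsTo_vertexPull_constFunctions K α) (mapsTo_vertexPull_sumZeroFunctions K α),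
    trace_vertexPull_constFunctions, trace_edgePull_cutSpace σ K hG]

/-- `tr(α^* | C¹) = tr(α^* | cut space) + tr(α^* | flow space)` over an ordered field (the tree's
`isCompl_cutSpace_flowSpace`). [cite: Deo2003, Proposition 4.9.9 (Hopf's Trace Formula), for the
cochain complex `C⁰(G) → C¹(G)`; BakerNorine2009, Proposition 36 (proof)] -/
theorem trace_edgePull_eq [LinearOrder K] [IsStrictOrderedRing K] (α : G ≃g G) :
    LinearMap.trace K (G.edgeSet → K) (edgePull σ K α) =
      LinearMap.trace K (σ.cutSpace K) ((edgePull σ K α).restrict (mapsTo_edgePull_cutSpace σ K α)) +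
        LinearMap.trace K (σ.flowSpace K)
          ((edgePull σ K α).restrict (mapsTo_edgePull_flowSpace σ K α)) :=
  trace_eq_add_of_isCompl (σ.isCompl_cutSpace_flowSpace K) _ _

/-- **The Hopf trace formula for a graph automorphism**: `tr(α^*|C⁰) − tr(α^*|C¹) = 1 −
tr(α^*|𝓗¹(G))` for a connected graph over an ordered field (the alternating sum of the traces on the
cochain complex `C⁰ → C¹` equals that on its cohomology `H⁰ = constants`, `H¹ ≅` flow space). [cite:
Deo2003, Proposition 4.9.9 (Hopf's Trace Formula), for the cochain complex `C⁰(G) → C¹(G)`;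
BakerNorine2009, Proposition 36 (proof)] -/
theorem trace_vertexPull_sub_trace_edgePull [LinearOrder K] [IsStrictOrderedRing K]
    (hG : G.Connected) (α : G ≃g G) :
    LinearMap.trace K (V → K) (vertexPull K α) - LinearMap.trace K (G.edgeSet → K) (edgePull σ K α) =
      1 - LinearMap.trace K (σ.flowSpace K)
        ((edgePull σ K α).restrict (mapsTo_edgePull_flowSpace σ K α)) := by
  rw [trace_vertexPull_eq σ K hG, trace_edgePull_eq σ K α]
  ring

/-- **The Hopf trace formula, counted**: `v₀ − Σ_{α e = e} ε_α(e) = 1 − tr(α^*|𝓗¹(G))`, where `v₀`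
is the number of fixed vertices. [cite: Deo2003, Proposition 4.9.9 (Hopf's Trace Formula), for the
cochain complex `C⁰(G) → C¹(G)`; BakerNorine2009, Proposition 36 (proof)] -/
theorem card_fixed_sub_sum_orientSign [LinearOrder K] [IsStrictOrderedRing K]
    (hG : G.Connected) (α : G ≃g G) :
    ((fixedVertices α).card : K) -
        ∑ e, (if α.mapEdgeSet e = e then orientSign σ K α e else 0) =
      1 - LinearMap.trace K (σ.flowSpace K)
        ((edgePull σ K α).restrict (mapsTo_edgePull_flowSpace σ K α)) := by
  rw [← trace_vertexPull, ← trace_edgePull, trace_vertexPull_sub_trace_edgePull σ K hG]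


/-! ### §5 The group law: `(αβ)^* = β^* α^*`, `1^* = id` -/

omit [Fintype V] [DecidableEq V] [DecidableRel G.Adj] in
/-- `(αβ)(e) = α(β(e))` on edges. [cite: BakerNorine2009, §4.3 («by functoriality»)] -/
theorem mapEdgeSet_mul (α β : G ≃g G) (e : G.edgeSet) :
    (α * β).mapEdgeSet e = α.mapEdgeSet (β.mapEdgeSet e) := by
  obtain ⟨e, he⟩ := e
  induction e using Sym2.ind with
  | _ x y => rfl

omit [Fintype V] [DecidableEq V] [DecidableRel G.Adj] in
/-- `1(e) = e` on edges. [cite: BakerNorine2009, §4.3 («by functoriality»)] -/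
theorem mapEdgeSet_one (e : G.edgeSet) : (1 : G ≃g G).mapEdgeSet e = e := by
  obtain ⟨e, he⟩ := e
  induction e using Sym2.ind with
  | _ x y => rfl

omit [Fintype V] [DecidableRel G.Adj] in
/-- The sign cocycle `ε_{αβ}(e) = ε_β(e) ε_α(β e)`. [cite: BakerNorine2009, §4.3 («an automorphism
`α` of a graph `G` induces an automorphism `α^*` of […] `𝓗¹(G)`»)] -/
theorem orientSign_mul (α β : G ≃g G) (e : G.edgeSet) :
    orientSign σ K (α * β) e = orientSign σ K β e * orientSign σ K α (β.mapEdgeSet e) := by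
  have hαβ := mapEdgeSet_mul α β e
  unfold orientSign
  rw [hαβ, RelIso.mul_apply]
  rcases head_tail_mapEdgeSet σ β e with ⟨h1, -⟩ | ⟨h1, h2⟩
  · rw [if_pos h1, one_mul, h1]
  · have hne : σ.head (β.mapEdgeSet e) ≠ β (σ.head e) := by
      rw [h1]
      exact fun h => (σ.head_ne_tail e).symm (β.injective h)
    rw [if_neg hne]
    rcases head_tail_mapEdgeSet σ α (β.mapEdgeSet e) with ⟨h3, -⟩ | ⟨h3, -⟩
    · rw [if_pos h3, if_neg]
      · ring
      · rw [h3, h1]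
        exact fun h => (σ.head_ne_tail e).symm (β.injective (α.injective h))
    · have hne' : σ.head (α.mapEdgeSet (β.mapEdgeSet e)) ≠ α (σ.head (β.mapEdgeSet e)) := by
        rw [h3]
        exact fun h => (σ.head_ne_tail _).symm (α.injective h)
      rw [if_neg hne', if_pos]
      · ring
      · rw [h3, h2]

omit [Fintype V] [DecidableRel G.Adj] in
/-- `ε_1(e) = 1`. [cite: BakerNorine2009, §4.3 («by functoriality»)] -/
theorem orientSign_one (e : G.edgeSet) : orientSign σ K (1 : G ≃g G) e = 1 :=
  orientSign_of_head_eq σ K (by rw [mapEdgeSet_one, RelIso.one_apply])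

omit [Fintype V] [DecidableRel G.Adj] in
/-- **`(αβ)^* = β^* ∘ α^*`** on edge vectors (pull-back is contravariant, «by functoriality»).
[cite: BakerNorine2009, §4.3 («`φ^*` as a contravariant functor»)] -/
theorem edgePull_mul (α β : G ≃g G) :
    edgePull σ K (α * β) = edgePull σ K β ∘ₗ edgePull σ K α := by
  refine LinearMap.ext fun x => funext fun e => ?_
  rw [LinearMap.comp_apply, edgePull_apply, edgePull_apply, edgePull_apply, orientSign_mul,
    mapEdgeSet_mul, mul_assoc]

omit [Fintype V] [DecidableRel G.Adj] in
/-- **`1^* = id`** on edge vectors. [cite: BakerNorine2009, §4.3 («`φ^*` as a contravariant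
functor»)] -/
theorem edgePull_one : edgePull σ K (1 : G ≃g G) = LinearMap.id := by
  refine LinearMap.ext fun x => funext fun e => ?_
  rw [edgePull_apply, orientSign_one, mapEdgeSet_one, one_mul, LinearMap.id_apply]

/-! ### §6 Proposition 36: `α^* = id` on `𝓗¹(G)` forces `α = 1` -/

/-- An edge is fixed together with its orientation iff both its ends are fixed. [cite:
BakerNorine2009, Proposition 36] -/
theorem mapEdgeSet_eq_and_head_eq_iff (α : G ≃g G) (e : G.edgeSet) :
    (α.mapEdgeSet e = e ∧ σ.head (α.mapEdgeSet e) = α (σ.head e)) ↔ e ∈ fixedEdges α := by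
  rw [mem_fixedEdges_iff σ]
  constructor
  · rintro ⟨he, hh⟩
    have h1 : α (σ.head e) = σ.head e := by rw [← hh, he]
    refine ⟨h1, ?_⟩
    rcases head_tail_mapEdgeSet σ α e with ⟨-, h2⟩ | ⟨h3, -⟩
    · rw [← h2, he]
    · exfalso
      rw [hh] at h3
      exact σ.head_ne_tail e (α.injective h3)
  · rintro ⟨h1, h2⟩
    have he : α.mapEdgeSet e = e :=
      Subtype.ext (by rw [coe_mapEdgeSet σ, h1, h2, σ.mk_head_tail])
    exact ⟨he, by rw [he, h1]⟩

/-- The head of an edge fixed at both ends is a fixed vertex. [cite: BakerNorine2009, Proposition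
36] -/
theorem head_mem_fixedVertices {α : G ≃g G} {e : G.edgeSet} (he : e ∈ fixedEdges α) :
    σ.head e ∈ fixedVertices α :=
  mem_fixedVertices_iff.2 ((mem_fixedEdges_iff σ).1 he).1

/-- **`tr(α^*|C¹) = e₊ − e₋`**: the signed count of fixed edges is the number of edges with both
ends fixed minus the number of edges fixed with their orientation reversed. [cite: Deo2003,
Proposition 4.9.9 (Hopf's Trace Formula), for the cochain complex `C⁰(G) → C¹(G)`; BakerNorine2009,
Proposition 36 (proof)] -/
theorem sum_orientSign_eq (α : G ≃g G) :
    ∑ e, (if α.mapEdgeSet e = e then orientSign σ K α e else 0) =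
      ((fixedEdges α).card : K) -
        (univ.filter fun e : G.edgeSet =>
          α.mapEdgeSet e = e ∧ σ.head (α.mapEdgeSet e) ≠ α (σ.head e)).card := by
  rw [← sum_filter,
    ← sum_filter_add_sum_filter_not _ (fun e => σ.head (α.mapEdgeSet e) = α (σ.head e)),
    filter_filter, filter_filter]
  have hF : univ.filter (fun e : G.edgeSet =>
      α.mapEdgeSet e = e ∧ σ.head (α.mapEdgeSet e) = α (σ.head e)) = fixedEdges α := by
    ext e
    rw [mem_filter, and_iff_right (mem_univ _), mapEdgeSet_eq_and_head_eq_iff σ]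
  have h1 : ∑ e ∈ univ.filter (fun e : G.edgeSet =>
      α.mapEdgeSet e = e ∧ σ.head (α.mapEdgeSet e) = α (σ.head e)), orientSign σ K α e =
        (fixedEdges α).card := by
    rw [hF, sum_congr rfl fun e he =>
      orientSign_of_head_eq σ K ((mapEdgeSet_eq_and_head_eq_iff σ α e).2 he).2,
      sum_const, nsmul_eq_mul, mul_one]
  have h2 : ∑ e ∈ univ.filter (fun e : G.edgeSet =>
      α.mapEdgeSet e = e ∧ ¬σ.head (α.mapEdgeSet e) = α (σ.head e)), orientSign σ K α e =
        -((univ.filter fun e : G.edgeSet =>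
          α.mapEdgeSet e = e ∧ σ.head (α.mapEdgeSet e) ≠ α (σ.head e)).card : K) := by
    rw [card_eq_sum_ones, Nat.cast_sum, ← sum_neg_distrib]
    refine sum_congr rfl fun e he => ?_
    rw [orientSign_of_head_ne σ K (mem_filter.1 he).2.2, Nat.cast_one]
  rw [h1, h2, ← sub_eq_add_neg]

/-! #### Functions supported on a finite set of coordinates -/

/-- The coordinate subspace `{x : ι → K | x = 0 off s}`. [folklore] -/
def supportedOn {ι : Type*} (s : Finset ι) : Submodule K (ι → K) where
  carrier := {x | ∀ i, i ∉ s → x i = 0}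
  add_mem' hx hy := fun i hi => by rw [Pi.add_apply, hx i hi, hy i hi, add_zero]
  zero_mem' := fun _ _ => rfl
  smul_mem' c x hx := fun i hi => by rw [Pi.smul_apply, hx i hi, smul_zero]

omit [Fintype V] [DecidableEq V] [DecidableRel G.Adj] in
/-- Membership in the coordinate subspace. [folklore] -/
private theorem mem_supportedOn_iff {ι : Type*} {s : Finset ι} {x : ι → K} :
    x ∈ supportedOn K s ↔ ∀ i, i ∉ s → x i = 0 := Iff.rfl

/-- `{x = 0 off s} ≃ (s → K)` (restriction to `s`). [folklore] -/
noncomputable def supportedOnEquiv {ι : Type*} [DecidableEq ι] (s : Finset ι) :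
    supportedOn K s ≃ₗ[K] (s → K) where
  toFun x := fun i => (x : ι → K) i
  invFun y := ⟨fun i => if h : i ∈ s then y ⟨i, h⟩ else 0, fun i hi => dif_neg hi⟩
  map_add' _ _ := rfl
  map_smul' _ _ := rfl
  left_inv x := by
    refine Subtype.ext (funext fun i => ?_)
    by_cases h : i ∈ s
    · simp only [dif_pos h]
    · simp only [dif_neg h, x.2 i h]
  right_inv y := funext fun i => by simp only [Subtype.coe_eta, dif_pos i.2]

omit [Fintype V] [DecidableEq V] [DecidableRel G.Adj] in
/-- `dim {x = 0 off s} = #s`. [folklore] -/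
private theorem finrank_supportedOn {ι : Type*} [DecidableEq ι] (s : Finset ι) :
    Module.finrank K (supportedOn K s) = s.card := by
  rw [LinearEquiv.finrank_eq (supportedOnEquiv K s), Module.finrank_fintype_fun_eq_card,
    Fintype.card_coe]

/-! #### The proof of Proposition 36 -/

/-- In a 2-edge-connected graph every edge carries a non-zero flow (the signed characteristic vector
of a cycle through it: «letting `ω` be the characteristic function of any simple cycle containing
`e`»). [cite: BakerNorine2009, Proposition 36 (proof: «Since `G` is 2-edge-connected, `e″` belongs
to a simple cycle»), Theorem 58 (proof of (5) ⇒ (1))] -/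
theorem exists_mem_flowSpace_apply_ne_zero (h2 : G.IsEdgeConnected 2) (e : G.edgeSet) :
    ∃ z ∈ σ.flowSpace K, z e ≠ 0 := by
  obtain ⟨e, he⟩ := e
  induction e using Sym2.ind with
  | _ x y =>
    have hxy : G.Adj x y := he
    have hnb : ¬G.IsBridge s(x, y) := fun hb =>
      isBridge_iff.1 hb ((isEdgeConnected_two.1 h2 s(x, y)) x y)
    rw [isBridge_iff_forall_cycle_notMem (G.mem_edgeSet.2 hxy)] at hnb
    push Not at hnb
    obtain ⟨u, c, hc, hce⟩ := hnb
    refine ⟨σ.walkVec K c, σ.walkVec_mem_flowSpace K c, ?_⟩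
    rcases σ.walkVec_apply_of_isTrail K hc.isTrail (e := ⟨s(x, y), he⟩) hce with h | h
    · rw [h]
      exact one_ne_zero
    · rw [h, neg_ne_zero]
      exact one_ne_zero

omit [DecidableEq V] in
/-- `g ≥ 2` forces an edge, hence two vertices. [cite: BakerNorine2009, Proposition 36] -/
theorem nontrivial_of_two_le_genus (hg : 2 ≤ genus G) : Nontrivial V := by
  rw [genus_eq] at hg
  have hE : 0 < #G.edgeFinset := by
    have : (0 : ℤ) < #G.edgeFinset := by
      linarith [(Nat.cast_nonneg (Fintype.card V) : (0 : ℤ) ≤ _)]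
    exact_mod_cast this
  obtain ⟨e, he⟩ := card_pos.1 hE
  rw [mem_edgeFinset] at he
  induction e using Sym2.ind with
  | _ x y => exact ⟨⟨x, y, G.ne_of_adj he⟩⟩

omit [Fintype V] [DecidableEq V] [DecidableRel G.Adj] in
/-- In a connected graph on at least two vertices every vertex has a neighbour. [folklore] -/
private theorem exists_adj_of_nontrivial [Nontrivial V] (hG : G.Connected) (v : V) : ∃ w, G.Adj v w := by
  obtain ⟨u, hu⟩ := exists_ne v
  obtain ⟨p⟩ := hG.preconnected v u
  exact ⟨p.snd, p.adj_snd (Walk.not_nil_of_ne hu.symm)⟩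

variable [LinearOrder K] [IsStrictOrderedRing K]

/-- **Proposition 36, edge-vector form.** If `G` is 2-edge-connected of genus `≥ 2` and the
automorphism `α` acts as the identity on the flow space (`= 𝓗¹(G)` read along `σ`), then `α = 1`
(«if `α^*` is the identity map on `𝓗¹(G)`, then `α` is the identity map on `G`»). [cite:
BakerNorine2009, Proposition 36] -/
theorem eq_one_of_edgePull_eq_self (h2 : G.IsEdgeConnected 2) (hg : 2 ≤ genus G) (α : G ≃g G)
    (hα : ∀ x ∈ σ.flowSpace K, edgePull σ K α x = x) : α = 1 := by
  haveI : Nontrivial V := nontrivial_of_two_le_genus hg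
  have hG : G.Connected := h2.connected (by norm_num)
  -- (1) `tr(α^* | flow space) = g`
  have hid : (edgePull σ K α).restrict (mapsTo_edgePull_flowSpace σ K α) = LinearMap.id :=
    LinearMap.ext fun x => Subtype.ext (hα x.1 x.2)
  have htr := card_fixed_sub_sum_orientSign σ K hG α
  rw [hid, LinearMap.trace_id, σ.finrank_flowSpace K, sum_orientSign_eq σ K α] at htr
  have hgc : genus G = corank G := genus_eq_corank hG
  -- abbreviations
  set S := fixedVertices α with hS
  set F := fixedEdges α with hF
  set m := (univ.filter fun e : G.edgeSet =>
    α.mapEdgeSet e = e ∧ σ.head (α.mapEdgeSet e) ≠ α (σ.head e)).card with hm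
  -- the Hopf identity in `ℕ`: `#S + m + g = 1 + #F`
  have hN : S.card + m + corank G = 1 + F.card := by
    have h' : ((S.card + m + corank G : ℕ) : K) = ((1 + F.card : ℕ) : K) := by
      push_cast
      linarith
    exact_mod_cast h'
  -- (2) the incidence mapping restricted to the vectors supported on `F`
  set DF : supportedOn K F →ₗ[K] (V → K) := (σ.incMatrix K).mulVecLin.domRestrict (supportedOn K F)
    with hDF
  have hrn := LinearMap.finrank_range_add_finrank_ker DF
  rw [finrank_supportedOn] at hrn
  -- its range lies in `{f = 0 off S} ∩ {Σ f = 0}`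
  have hrange : LinearMap.range DF ≤ supportedOn K S ⊓ sumZeroFunctions V K := by
    rintro f ⟨x, rfl⟩
    refine ⟨fun u hu => ?_, ?_⟩
    · rw [hDF, LinearMap.domRestrict_apply, Matrix.mulVecLin_apply, Matrix.mulVec, dotProduct]
      refine sum_eq_zero fun e _ => ?_
      by_cases hx : (x : G.edgeSet → K) e = 0
      · rw [hx, mul_zero]
      · have he : e ∈ F := by
          by_contra he
          exact hx (x.2 e he)
        have hu' : u ∉ (e : Sym2 V) := by
          intro hue
          rcases σ.mem_iff.1 hue with rfl | rfl
          · exact hu (head_mem_fixedVertices σ he)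
          · exact hu (mem_fixedVertices_iff.2 ((mem_fixedEdges_iff σ).1 he).2)
        rw [σ.incMatrix_of_not_mem K hu', zero_mul]
    · rw [SetLike.mem_coe, mem_sumZeroFunctions_iff, hDF, LinearMap.domRestrict_apply,
        Matrix.mulVecLin_apply]
      simp_rw [Matrix.mulVec, dotProduct]
      rw [sum_comm]
      refine sum_eq_zero fun e _ => ?_
      rw [← sum_mul, σ.sum_incMatrix K, zero_mul]
  -- its kernel, pushed into the edge space, lies in the flow space
  have hker : (LinearMap.ker DF).map (supportedOn K F).subtype ≤ σ.flowSpace K := by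
    rintro z ⟨x, hx, rfl⟩
    have hx' : DF x = 0 := hx
    rw [hDF, LinearMap.domRestrict_apply, Matrix.mulVecLin_apply] at hx'
    exact (σ.mem_flowSpace_iff K).2 hx'
  have hker' : Module.finrank K ((LinearMap.ker DF).map (supportedOn K F).subtype) =
      Module.finrank K (LinearMap.ker DF) := Submodule.finrank_map_subtype_eq _ _
  have hnul : Module.finrank K (LinearMap.ker DF) ≤ corank G := by
    rw [← hker', ← σ.finrank_flowSpace K]
    exact Submodule.finrank_mono hker
  -- (3) `S` is non-empty (else `e₊ = 0` and the Hopf identity contradicts `g ≥ 2`)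
  have hSne : S.Nonempty := by
    by_contra hS0
    rw [not_nonempty_iff_eq_empty] at hS0
    have hF0 : F = ∅ := by
      rw [eq_empty_iff_forall_notMem]
      intro e he
      have h := head_mem_fixedVertices σ he
      rw [← hS, hS0] at h
      exact notMem_empty _ h
    rw [hS0, hF0, card_empty, card_empty] at hN
    have : (2 : ℤ) ≤ corank G := hgc ▸ hg
    omega
  -- (4) the range has dimension `≤ #S − 1`
  have hrk : Module.finrank K (LinearMap.range DF) + 1 ≤ S.card := by
    obtain ⟨v₀, hv₀⟩ := hSne
    have hlt : supportedOn K S ⊓ sumZeroFunctions V K < supportedOn K S := by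
      refine lt_of_le_of_ne inf_le_left fun h => ?_
      have hmem : (Pi.single v₀ (1 : K) : V → K) ∈ supportedOn K S := fun u hu => by
        rw [Pi.single_apply, if_neg]
        rintro rfl
        exact hu hv₀
      rw [← h] at hmem
      have hs := (mem_sumZeroFunctions_iff K).1 hmem.2
      rw [Finset.sum_pi_single', if_pos (mem_univ _)] at hs
      exact one_ne_zero hs
    have h1 := Submodule.finrank_lt_finrank_of_lt hlt
    have h2 := Submodule.finrank_mono hrange
    rw [finrank_supportedOn] at h1
    omega
  -- (5) hence the kernel has dimension exactly `g`, i.e. every flow is supported on `F`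
  have hnul' : Module.finrank K (LinearMap.ker DF) = corank G := by omega
  have heq : (LinearMap.ker DF).map (supportedOn K F).subtype = σ.flowSpace K :=
    Submodule.eq_of_le_of_finrank_eq hker (by rw [hker', hnul', σ.finrank_flowSpace K])
  have hsupp : ∀ z ∈ σ.flowSpace K, ∀ e, e ∉ F → z e = 0 := by
    intro z hz e he
    rw [← heq] at hz
    obtain ⟨x, -, rfl⟩ := hz
    exact x.2 e he
  -- (6) every edge carries a non-zero flow, so every edge, hence every vertex, is fixed
  have hall : ∀ e : G.edgeSet, e ∈ F := fun e => by
    by_contra he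
    obtain ⟨z, hz, hze⟩ := exists_mem_flowSpace_apply_ne_zero σ K h2 e
    exact hze (hsupp z hz e he)
  refine RelIso.ext fun v => ?_
  rw [RelIso.one_apply]
  obtain ⟨w, hvw⟩ := exists_adj_of_nontrivial hG v
  have he := (mem_fixedEdges_iff σ).1 (hall ⟨s(v, w), hvw⟩)
  rcases σ.head_tail_of_adj hvw with ⟨h1, -⟩ | ⟨-, h1⟩
  · rw [h1] at he
    exact he.1
  · rw [h1] at he
    exact he.2


/-- **Proposition 36, injectivity form**: two automorphisms inducing the same map on the flow space
are equal («By considering the automorphism `α := β′β⁻¹`, it suffices to prove that if `α^*` is the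
identity map on `𝓗¹(G)`, then `α` is the identity»). [cite: BakerNorine2009, Proposition 36] -/
theorem eq_of_edgePull_eq (h2 : G.IsEdgeConnected 2) (hg : 2 ≤ genus G) {α β : G ≃g G}
    (h : ∀ x ∈ σ.flowSpace K, edgePull σ K α x = edgePull σ K β x) : α = β := by
  rw [← mul_inv_eq_one]
  refine eq_one_of_edgePull_eq_self σ K h2 hg (α * β⁻¹) fun x hx => ?_
  rw [edgePull_mul, LinearMap.comp_apply, h x hx, ← LinearMap.comp_apply, ← edgePull_mul,
    mul_inv_cancel, edgePull_one, LinearMap.id_apply]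

/-! ### §7 Back to B–N's 1-cochains: `α^*ω` and Proposition 36 as printed -/

omit [Fintype V] [LinearOrder K] [IsStrictOrderedRing K] in
/-- Reading B–N's pull-back `α^*ω` of a 1-cochain along `σ` gives `α^*` on edge vectors: `edgeVec σ
(α^*ω) = α^*(edgeVec σ ω)`. [cite: BakerNorine2009, §4.3 («`(φ^*ω′)(e) := ω′(φ(e))`»)] -/
theorem edgeVec_cochainPullback (α : G ≃g G) {ω : V → V → K} (hω : IsOneCochain G ω) :
    edgeVec σ (cochainPullback G α ω) = edgePull σ K α (edgeVec σ ω) := by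
  funext e
  rw [edgeVec_apply, cochainPullback_apply, if_pos (σ.adj_head_tail e).symm, edgePull_apply,
    edgeVec_apply]
  rcases head_tail_mapEdgeSet σ α e with ⟨h1, h2⟩ | ⟨h1, h2⟩
  · rw [orientSign_of_head_eq σ K h1, one_mul, h1, h2]
  · have hne : σ.head (α.mapEdgeSet e) ≠ α (σ.head e) := by
      rw [h1]
      exact fun h => (σ.head_ne_tail e).symm (α.injective h)
    rw [orientSign_of_head_ne σ K hne, h1, h2, hω.antisymm' (α (σ.tail e)), neg_one_mul, neg_neg]

omit [LinearOrder K] [IsStrictOrderedRing K] in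
/-- An automorphism pulls flows back to flows. [cite: BakerNorine2009, Proposition 34 (1), Example
20] -/
theorem IsGraphFlow.cochainPullback_iso (α : G ≃g G) {ω : V → V → K} (hω : IsGraphFlow G ω) :
    IsGraphFlow G (cochainPullback G α ω) :=
  hω.pullback (isHarmonicMorphism_iso α)

/-- **Proposition 36** (Baker–Norine): if `G` is 2-edge-connected of genus `g ≥ 2` and the
automorphism `α` satisfies `α^*ω = ω` for every harmonic 1-form `ω ∈ 𝓗¹(G) = H¹(G, K)` (`K` an
ordered field, e.g. `ℝ`), then `α` is the identity. [cite: BakerNorine2009, Proposition 36] -/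
theorem eq_one_of_cochainPullback_eq_self (h2 : G.IsEdgeConnected 2) (hg : 2 ≤ genus G)
    (α : G ≃g G) (hα : ∀ ω : V → V → K, IsGraphFlow G ω → cochainPullback G α ω = ω) :
    α = 1 := by
  set σ := someOrientation G
  refine eq_one_of_edgePull_eq_self σ K h2 hg α fun x hx => ?_
  have hω := (mem_flowSpace_iff_isGraphFlow σ x).1 hx
  rw [← edgeVec_ofEdgeVec σ x, ← edgeVec_cochainPullback σ K α hω.toIsOneCochain, hα _ hω]

/-- **Proposition 36, as printed**: «If `G` is a 2-edge-connected graph of genus at least `2`, then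
the natural map from `Aut(G)` to `Aut(𝓗¹(G))` is injective» — two automorphisms with `α^* = β^*` on
`𝓗¹(G)` coincide. [cite: BakerNorine2009, Proposition 36] -/
theorem eq_of_cochainPullback_eq (h2 : G.IsEdgeConnected 2) (hg : 2 ≤ genus G) {α β : G ≃g G}
    (h : ∀ ω : V → V → K, IsGraphFlow G ω → cochainPullback G α ω = cochainPullback G β ω) :
    α = β := by
  set σ := someOrientation G
  refine eq_of_edgePull_eq σ K h2 hg fun x hx => ?_
  have hω := (mem_flowSpace_iff_isGraphFlow σ x).1 hx
  rw [← edgeVec_ofEdgeVec σ x, ← edgeVec_cochainPullback σ K α hω.toIsOneCochain,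
    ← edgeVec_cochainPullback σ K β hω.toIsOneCochain, h _ hω]

/-- **The natural map `Aut(G) → End(𝓗¹(G))`, `α ↦ α^*`** (`α` is a harmonic morphism of degree `1`,
Example 20, so `α^*` preserves `𝓗¹(G)` by Proposition 34 (1)). [cite: BakerNorine2009, §4.3 («an
automorphism `α` of a graph `G` induces an automorphism `α^*` of […] `𝓗¹(G)`»)] -/
noncomputable def oneFormPullback (α : G ≃g G) : flowSubmodule G K K →ₗ[K] flowSubmodule G K K where
  toFun ω := ⟨cochainPullback G α ω.1, IsGraphFlow.cochainPullback_iso K α ω.2⟩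
  map_add' ω₁ ω₂ := by
    refine Subtype.ext (funext fun u => funext fun x => ?_)
    simp only [Submodule.coe_add, cochainPullback_apply, Pi.add_apply]
    split_ifs <;> simp
  map_smul' c ω := by
    refine Subtype.ext ?_
    simp only [Submodule.coe_smul, RingHom.id_apply, cochainPullback_smul]

omit [LinearOrder K] [IsStrictOrderedRing K] in
/-- Unfolding `α^*` on `H¹(G, K)`. [cite: BakerNorine2009, §4.3 («an automorphism `α` of a graph `G`
induces an automorphism `α^*` of […] `𝓗¹(G)`»)] -/
@[simp] theorem oneFormPullback_apply (α : G ≃g G) (ω : flowSubmodule G K K) :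
    (oneFormPullback K α ω : V → V → K) = cochainPullback G α ω.1 := rfl

/-- **Proposition 36**: «the natural map from `Aut(G)` to `Aut(𝓗¹(G))` is injective» for a
2-edge-connected graph of genus at least `2`. [cite: BakerNorine2009, Proposition 36] -/
theorem oneFormPullback_injective (h2 : G.IsEdgeConnected 2) (hg : 2 ≤ genus G) :
    Function.Injective (oneFormPullback (G := G) K) := fun α β h =>
  eq_of_cochainPullback_eq K h2 hg fun ω hω => by
    have := congr_arg (fun f => (f ⟨ω, hω⟩ : V → V → K)) h
    simpa only [oneFormPullback_apply] using this

end Literature.Combinatorics.SimpleGraph.BakerNorine
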